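import Summits.Ventures.YMGap.RobustBall.KernelClusteringBall
import Summits.Ventures.YMGap.RobustBall.OneStateBoundary
import Summits.Ventures.YMGap.RobustBall.BoundaryDecayBall
import Summits.Ventures.YMGap.RobustBall.BoundaryDecayTorus
import Summits.Ventures.YMGap.Thresholds.PlaquetteSusceptibility
import Summits.Ventures.YMGap.Thresholds.CouplingDerivativeTools
import HarnessLib

/-!
# Venture YMGap, track ROBUST-BALL — C-KMIX (V), rate form: the finite-volume plaquette susceptibility with ANY boundary field
# converges to the infinite-volume susceptibility EXPONENTIALLY FAST IN THE DEPTH of the plaquette (SU(2), `ℤ⁴`, `β_W ≤ 1/12`)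

HONEST FRAMING. WHAT THIS IS: a venture file (cell `pub-ymgap`, track Y2 ROBUST-BALL, seat ds-3, theorems only), the quantitative companion
of `KernelSusceptibilityLimit.su2_wilson_kernel_susceptibility_tendsto`. For `SU(2)` lattice Yang–Mills on `ℤ⁴` at `0 ≤ β_W ≤ 1/12` (tree
coupling `β_W/2`; the DLR states form a singleton `{μ}`) there is ONE constant `A` with: for every finite link volume `Λ`, every boundary
field `η`, every plaquette `p` and every `D : ℕ` such that every link outside `Λ` has base point at sup-distance `≥ D` from the base
point of `p`,

  `|Σ_q cov_{γ_Λ(·|η)}(W_p, W_q) − Σ_q cov_μ(W_p, W_q)| ≤ A · e^{−(log 2/19)·D}`   (`su2_wilson_kernel_susceptibility_rate`),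

both series (over all plaquettes `q` of `ℤ⁴`) converging absolutely. MECHANISM: plaquettes `q` with `‖x_p − x_q‖₁ ≤ 16D/19` are handled by
the cell's boundary-insensitivity theorem `BoundaryDecayBall.su2_wilson_boundary_upTo_oneTwelfth` (applied to `W_p`, `W_q` and the
Lipschitz cylinder `W_pW_q`, all at depth `≥ D − 16D/19 − 1`), the others by the kernel clustering
`KernelClusteringBall.su2_wilson_kernel_clustering_upTo_oneTwelfth` (uniform in `(Λ, η)`; the same bound passes to `μ` as the
boundary limit) and rb-p1's `ℓ¹` lattice sums; the two halves are balanced at the rate `(log 2)/19` per lattice unit (no serious optimisation).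
WHAT THIS IS NOT: the Wilson point / single-link door only; the rate is far from optimal; lattice strong coupling; nothing about the
continuum limit or the Clay problem.

References: B. Simon, *The Statistical Mechanics of Lattice Gases* I (1993), §III.2; R. L. Dobrushin, S. B. Shlosman, in *Statistical
Physics and Dynamical Systems* (1985), 347–370 (finite-volume mixing); the tree's `KernelClusteringBall.lean`, `BoundaryDecayBall.lean`.
-/

noncomputable section

open MeasureTheory Filter Function ProbabilityTheory Real Topology
open scoped NNReal
open Literature.Probability.LatticeModels
open Literature.MathematicalPhysics.QuantumLattice
open Literature.MathematicalPhysics.QuantumFieldTheory hiding ZdEdge Site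
open Summit.Ventures.YMGap.PlaquetteSusceptibility (exp_neg_latticeNorm_le_pow)
open Summit.Ventures.YMGap.CouplingResponse (isLipschitzCylinder_mul)

namespace Summit.Ventures.YMGap.RobustBall

namespace KernelSusceptibilityRate

/-- Depth bookkeeping: if every link outside `Λ` is at sup-distance `≥ D` from `x_p` and `‖x_p − x_q‖₁ ≤ M`, then every link of the
plaquettes `p`, `q` is at sup-distance `≥ D − M − 1` (truncated subtraction) from every link outside `Λ`. [folklore] -/
theorem depth_of_union {Λ : Finset (ZdEdge 4)} {p q : ZdPlaquette 4} {D M : ℕ}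
    (hD : ∀ z : ZdEdge 4, z ∉ Λ → (D : ℝ) ≤ ‖p.1 - z.1‖) (hq : l1 (p.1 - q.1) ≤ M) :
    ∀ y ∈ plaquetteEdges p ∪ plaquetteEdges q, ∀ z : ZdEdge 4, z ∉ Λ → ((D - M - 1 : ℕ) : ℝ) ≤ ‖y.1 - z.1‖ := by
  intro y hy z hz
  have hyp : ‖y.1 - p.1‖ ≤ 1 + M := by
    rcases Finset.mem_union.1 hy with hy | hy
    · have := norm_fst_sub_le_of_mem_plaquetteEdges hy
      have hM : (0 : ℝ) ≤ M := Nat.cast_nonneg M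
      linarith
    · have h1 := norm_fst_sub_le_of_mem_plaquetteEdges hy
      have h2 : ‖q.1 - p.1‖ ≤ M := by
        have := norm_le_l1 (q.1 - p.1)
        rw [l1_sub_comm] at this
        exact this.trans (by exact_mod_cast hq)
      calc ‖y.1 - p.1‖ = ‖(y.1 - q.1) + (q.1 - p.1)‖ := by congr 1; abel
        _ ≤ ‖y.1 - q.1‖ + ‖q.1 - p.1‖ := norm_add_le _ _
        _ ≤ 1 + M := add_le_add h1 h2
  have htri : ‖p.1 - z.1‖ ≤ ‖y.1 - p.1‖ + ‖y.1 - z.1‖ := by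
    calc ‖p.1 - z.1‖ = ‖(y.1 - z.1) - (y.1 - p.1)‖ := by congr 1; abel
      _ ≤ ‖y.1 - z.1‖ + ‖y.1 - p.1‖ := norm_sub_le _ _
      _ = ‖y.1 - p.1‖ + ‖y.1 - z.1‖ := add_comm _ _
  have hDz := hD z hz
  rcases le_or_gt (M + 1) D with hle | hlt
  · have : ((D - M - 1 : ℕ) : ℝ) = (D : ℝ) - M - 1 := by
      rw [Nat.sub_sub, Nat.cast_sub hle]; push_cast; ring
    rw [this]; linarith
  · have : (D - M - 1 : ℕ) = 0 := by omega
    rw [this, Nat.cast_zero]; exact norm_nonneg _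

/-- Exponent bookkeeping for the near half: with `M = ⌊16D/19⌋`, `D' = D − M − 1` (natural-number operations) and `c ≥ 0`,
`e^{−c D'} · e^{c M/8} ≤ e^{c} · e^{−(c/19) D}`. [folklore] -/
theorem susceptibilityRate_near_exponent_le {c : ℝ} (hc : 0 ≤ c) (D : ℕ) :
    Real.exp (-(c * ((D - 16 * D / 19 - 1 : ℕ) : ℝ))) * Real.exp (c * (16 * D / 19 : ℕ) / 8) ≤
      Real.exp c * Real.exp (-(c / 19) * D) := by
  rw [← Real.exp_add, ← Real.exp_add]
  refine Real.exp_le_exp.2 ?_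
  have hM : (((16 * D / 19 : ℕ) : ℝ)) ≤ 16 * (D : ℝ) / 19 := by
    have h := (Nat.cast_div_le (m := 16 * D) (n := 19) : ((16 * D / 19 : ℕ) : ℝ) ≤ _)
    push_cast at h
    linarith
  have key : -((D - 16 * D / 19 - 1 : ℕ) : ℝ) + ((16 * D / 19 : ℕ) : ℝ) / 8 ≤ 1 - (D : ℝ) / 19 := by
    rcases le_or_gt (16 * D / 19 + 1) D with hle | hlt
    · have : ((D - 16 * D / 19 - 1 : ℕ) : ℝ) = (D : ℝ) - ((16 * D / 19 : ℕ) : ℝ) - 1 := by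
        rw [Nat.sub_sub, Nat.cast_sub hle]; push_cast; ring
      rw [this]; linarith
    · have hD0 : D = 0 := by omega
      subst hD0; simp
  have := mul_le_mul_of_nonneg_left key hc
  linarith [this]

/-- Exponent bookkeeping for the far half: with `M = ⌊16D/19⌋` and `c ≥ 0`, `(e^{−c/16})^{M} ≤ e^{c} · e^{−(c/19) D}`. [folklore] -/
theorem susceptibilityRate_far_exponent_le {c : ℝ} (hc : 0 ≤ c) (D : ℕ) :
    Real.exp (-(c / 16)) ^ (16 * D / 19 : ℕ) ≤ Real.exp c * Real.exp (-(c / 19) * D) := by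
  rw [← Real.exp_nat_mul, ← Real.exp_add]
  refine Real.exp_le_exp.2 ?_
  have h2 : 16 * (D : ℝ) ≤ 19 * ((16 * D / 19 : ℕ) : ℝ) + 18 := by
    have : 16 * D ≤ 19 * (16 * D / 19) + 18 := by omega
    exact_mod_cast this
  nlinarith

/-- ★★ **THE FINITE-VOLUME SUSCEPTIBILITY WITH ANY BOUNDARY FIELD CONVERGES EXPONENTIALLY FAST IN THE DEPTH** (`SU(2)`, `ℤ⁴`,
`0 ≤ β_W ≤ 1/12`, tree coupling `β_W/2`): the DLR states form a singleton `{μ}` and there is a constant `A` such that for every finite link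
volume `Λ`, every boundary field `η`, every plaquette `p = (x; i<j)` and every `D : ℕ` with `‖x − x_z‖_∞ ≥ D` for all links `z ∉ Λ`:
both `q ↦ cov_{γ_Λ(·|η)}(W_p, W_q)` and `q ↦ cov_μ(W_p, W_q)` are summable over all plaquettes of `ℤ⁴` and
`|Σ_q cov_{γ_Λ(·|η)}(W_p, W_q) − Σ_q cov_μ(W_p, W_q)| ≤ A · exp(−(log 2/19) · D)`. [folklore] -/
theorem su2_wilson_kernel_susceptibility_rate {βW : ℝ} (h0 : 0 ≤ βW) (h : βW ≤ 1 / 12) :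
    ∃ μ : Measure (LGConfig 4 (Matrix.specialUnitaryGroup (Fin 2) ℂ)),
      ymGibbsMeasures (d := 4) (fundamentalRep (Fin 2)) (βW / 2) = {μ} ∧
      ∃ A : ℝ, ∀ (Λ : Finset (ZdEdge 4)) (η : LGConfig 4 (Matrix.specialUnitaryGroup (Fin 2) ℂ)) (p : ZdPlaquette 4) (D : ℕ),
        (∀ z : ZdEdge 4, z ∉ Λ → (D : ℝ) ≤ ‖p.1 - z.1‖) →
        (Summable fun q : ZdPlaquette 4 => cov[zdPlaquetteObs (fundamentalRep (Fin 2)) p.1 p.2.1.1 p.2.1.2,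
            zdPlaquetteObs (fundamentalRep (Fin 2)) q.1 q.2.1.1 q.2.1.2;
            ymSpecification (d := 4) (fundamentalRep (Fin 2)) (βW / 2) Λ η]) ∧
        (Summable fun q : ZdPlaquette 4 => cov[zdPlaquetteObs (fundamentalRep (Fin 2)) p.1 p.2.1.1 p.2.1.2,
            zdPlaquetteObs (fundamentalRep (Fin 2)) q.1 q.2.1.1 q.2.1.2; μ]) ∧
        |(∑' q : ZdPlaquette 4, cov[zdPlaquetteObs (fundamentalRep (Fin 2)) p.1 p.2.1.1 p.2.1.2,
              zdPlaquetteObs (fundamentalRep (Fin 2)) q.1 q.2.1.1 q.2.1.2;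
              ymSpecification (d := 4) (fundamentalRep (Fin 2)) (βW / 2) Λ η]) -
            ∑' q : ZdPlaquette 4, cov[zdPlaquetteObs (fundamentalRep (Fin 2)) p.1 p.2.1.1 p.2.1.2,
              zdPlaquetteObs (fundamentalRep (Fin 2)) q.1 q.2.1.1 q.2.1.2; μ]| ≤
          A * Real.exp (-(Real.log 2 / 19) * D) := by
  classical
  -- the unique state, an exhaustion, and the boundary-limit theorem (star window ⊇ the Wilson point)
  have hβ : |βW / 4| ≤ 9 / 100 := by rw [abs_of_nonneg (by linarith)]; linarith
  obtain ⟨μ, hG, hlim⟩ := boundaryLimit_of_massGapAt (d := 4) (ImprovedThresholdStar.su2_massGapAt_of_abs_le hβ)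
  have e2 : (((2 : ℕ) : ℝ) * (βW / 4) : ℝ) = βW / 2 := by push_cast; ring
  rw [e2] at hG hlim
  have hμ : μ ∈ ymGibbsMeasures (d := 4) (fundamentalRep (Fin 2)) (βW / 2) := by rw [hG]; exact Set.mem_singleton μ
  have hμG : IsGibbsMeasure (ymSpecification (d := 4) (fundamentalRep (Fin 2)) (βW / 2)) μ := hμ
  haveI := hμG.isProbabilityMeasure
  obtain ⟨Λs, hcof⟩ := exists_exhaustion 4
  obtain ⟨hF, -⟩ := hlim Λs hcof
  set γ := ymSpecification (d := 4) (fundamentalRep (Fin 2)) (βW / 2) with hγdef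
  haveI hγprob : ∀ Λ η, IsProbabilityMeasure (γ Λ η) := fun Λ η =>
    isProbabilityMeasure_ymSpecification _ (continuous_fundamentalRep (Fin 2)) _ Λ η
  set W : ZdPlaquette 4 → LGConfig 4 (Matrix.specialUnitaryGroup (Fin 2) ℂ) → ℝ :=
    fun r => zdPlaquetteObs (fundamentalRep (Fin 2)) r.1 r.2.1.1 r.2.1.2 with hW
  -- plaquette observables: Lipschitz cylinders (constant 32 on their four links), continuous, bounded by one, in `L²`
  have hWlip : ∀ r : ZdPlaquette 4, IsLipschitzCylinder (fundamentalRep (Fin 2)) (W r) (plaquetteEdges r) (4 * (2 : ℝ≥0) ^ 3) := by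
    rintro ⟨x, ⟨i, j⟩, hij⟩; exact isLipschitzCylinder_zdPlaquetteObs (N := 2) x hij
  have hWc : ∀ r : ZdPlaquette 4, Continuous (W r) := fun r => continuous_of_isLipschitzCylinder (hWlip r)
  have hWb : ∀ r : ZdPlaquette 4, ∀ U, |W r U| ≤ 1 := fun r U =>
    abs_zdPlaquetteObs_le fundamentalRep_mem_unitaryGroup r.1 r.2.1.1 r.2.1.2 U
  have hWb' : ∀ r : ZdPlaquette 4, ∀ U, |W r U| ≤ ((1 : ℝ≥0) : ℝ) := fun r U => by rw [NNReal.coe_one]; exact hWb r U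
  have hWmem : ∀ (r : ZdPlaquette 4) (ν : Measure (LGConfig 4 (Matrix.specialUnitaryGroup (Fin 2) ℂ)))
      [IsProbabilityMeasure ν], MemLp (W r) 2 ν := fun r ν _ =>
    memLp_of_bounded (a := -1) (b := 1) (ae_of_all _ fun U => by simp only [Set.mem_Icc]; exact abs_le.1 (hWb r U))
      (hWc r).measurable.aestronglyMeasurable 2
  have hWint : ∀ (r : ZdPlaquette 4) (ν : Measure (LGConfig 4 (Matrix.specialUnitaryGroup (Fin 2) ℂ)))
      [IsProbabilityMeasure ν], |∫ U, W r U ∂ν| ≤ 1 := fun r ν _ => by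
    have := norm_integral_le_of_norm_le_const (μ := ν) (f := W r) (C := 1)
      (ae_of_all _ fun U => by rw [Real.norm_eq_abs]; exact hWb r U)
    simpa [Real.norm_eq_abs, probReal_univ] using this
  -- the covariance as `∫ W_p W_q − ∫ W_p ∫ W_q`
  have hcov : ∀ (p q : ZdPlaquette 4) (ν : Measure (LGConfig 4 (Matrix.specialUnitaryGroup (Fin 2) ℂ)))
      [IsProbabilityMeasure ν], cov[W p, W q; ν] = (∫ U, W p U * W q U ∂ν) - (∫ U, W p U ∂ν) * ∫ U, W q U ∂ν :=
    fun p q ν _ => covariance_eq_sub (hWmem p _) (hWmem q _)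
  -- termwise convergence of the kernel covariances to the covariances of `μ` along the exhaustion (any boundary fields)
  have hterm : ∀ (p q : ZdPlaquette 4) (η : LGConfig 4 (Matrix.specialUnitaryGroup (Fin 2) ℂ)),
      Tendsto (fun n => cov[W p, W q; γ (Λs n) η]) atTop (𝓝 (cov[W p, W q; μ])) := by
    intro p q η
    have h1 := hF (fun _ => η) (fun U => W p U * W q U) ((hWc p).mul (hWc q))
      ⟨1, fun U => by rw [abs_mul]; exact mul_le_one₀ (hWb p U) (abs_nonneg _) (hWb q U)⟩
    have h2 := hF (fun _ => η) (W p) (hWc p) ⟨1, hWb p⟩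
    have h3 := hF (fun _ => η) (W q) (hWc q) ⟨1, hWb q⟩
    have hcovn : ∀ n, cov[W p, W q; γ (Λs n) η] =
        (∫ U, W p U * W q U ∂(γ (Λs n) η)) - (∫ U, W p U ∂(γ (Λs n) η)) * ∫ U, W q U ∂(γ (Λs n) η) :=
      fun n => hcov p q _
    rw [show (fun n => cov[W p, W q; γ (Λs n) η]) = fun n =>
        (∫ U, W p U * W q U ∂(γ (Λs n) η)) - (∫ U, W p U ∂(γ (Λs n) η)) * ∫ U, W q U ∂(γ (Λs n) η) from funext hcovn,
      hcov p q μ]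
    exact h1.sub (h2.mul h3)
  -- uniform domination from the kernel clustering at the Wilson point, and the same bound for `μ` in the limit
  set c : ℝ := Real.log 2 with hc
  have hc0 : 0 < c := Real.log_pos (by norm_num)
  set C' : ℝ := max (max (16 * 32) 0 * Real.exp (2 * c) *
      (((4 * (2 : ℝ≥0) ^ 3 : ℝ≥0) : ℝ) * ((4 * (2 : ℝ≥0) ^ 3 : ℝ≥0) : ℝ) + 1)) (4 * Real.exp (2 * c)) with hC'
  have hC'0 : 0 ≤ C' := le_max_of_le_right (by positivity)
  have h4 : (0 : ℝ) < ((4 : ℕ) : ℝ) := by norm_num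
  have hsqrt4 : Real.sqrt ((4 : ℕ) : ℝ) = 2 := by
    rw [show (((4 : ℕ) : ℝ)) = (2 : ℝ) ^ 2 by norm_num, Real.sqrt_sq (by norm_num : (0 : ℝ) ≤ 2)]
  set r : ℝ := exp (-(c / Real.sqrt ((4 : ℕ) : ℝ) / ((4 : ℕ) : ℝ))) with hr
  have hr8 : r = exp (-(c / 8)) := by rw [hr, hsqrt4]; congr 1; push_cast; ring
  have hr0 : 0 ≤ r := (exp_pos _).le
  have hr1 : r < 1 := Real.exp_lt_one_iff.2 (neg_neg_of_pos (div_pos (div_pos hc0 (Real.sqrt_pos.2 h4)) h4))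
  have hbound : ∀ (Λ : Finset (ZdEdge 4)) (η : LGConfig 4 (Matrix.specialUnitaryGroup (Fin 2) ℂ)) (p q : ZdPlaquette 4),
      |cov[W p, W q; γ Λ η]| ≤ C' * r ^ l1 (p.1 - q.1) := by
    intro Λ η p q
    have hcl : ∀ (F₁ F₂ : LGConfig 4 (Matrix.specialUnitaryGroup (Fin 2) ℂ) → ℝ) (Λ₁ Λ₂ : Finset (ZdEdge 4)) (K₁ K₂ : ℝ≥0),
        Λ₁.card ≤ 4 → Λ₂.card ≤ 4 → Disjoint Λ₁ Λ₂ →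
        IsLipschitzCylinder (fundamentalRep (Fin 2)) F₁ Λ₁ K₁ → IsLipschitzCylinder (fundamentalRep (Fin 2)) F₂ Λ₂ K₂ →
          |cov[F₁, F₂; γ Λ η]| ≤ 16 * 32 * Real.exp (-c * setDistEdges Λ₁ Λ₂) *
            ((K₁ : ℝ) * K₂ + Real.sqrt (∫ U, F₁ U ^ 2 ∂(γ Λ η)) * Real.sqrt (∫ U, F₂ U ^ 2 ∂(γ Λ η))) := by
      intro F₁ F₂ Λ₁ Λ₂ K₁ K₂ h₁ h₂ _ hF₁ hF₂
      have hk := su2_wilson_kernel_clustering_upTo_oneTwelfth h0 h Λ η hF₁ hF₂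
      have hn₁ : (Λ₁.card : ℝ) ≤ 4 := by exact_mod_cast h₁
      have hn₂ : (Λ₂.card : ℝ) ≤ 4 := by exact_mod_cast h₂
      have hL : (0 : ℝ) ≤ Real.sqrt (∫ U, F₁ U ^ 2 ∂(γ Λ η)) * Real.sqrt (∫ U, F₂ U ^ 2 ∂(γ Λ η)) := by positivity
      refine hk.trans ?_
      calc 32 * (Λ₁.card : ℝ) * Λ₂.card * ((K₁ : ℝ) * K₂) * exp (-Real.log 2 * setDistEdges Λ₁ Λ₂)
          ≤ 32 * 4 * 4 * ((K₁ : ℝ) * K₂ + Real.sqrt (∫ U, F₁ U ^ 2 ∂(γ Λ η)) * Real.sqrt (∫ U, F₂ U ^ 2 ∂(γ Λ η))) *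
              exp (-c * setDistEdges Λ₁ Λ₂) := by
            rw [hc]; gcongr; exact le_add_of_nonneg_right hL
        _ = 16 * 32 * Real.exp (-c * setDistEdges Λ₁ Λ₂) *
            ((K₁ : ℝ) * K₂ + Real.sqrt (∫ U, F₁ U ^ 2 ∂(γ Λ η)) * Real.sqrt (∫ U, F₂ U ^ 2 ∂(γ Λ η))) := by ring
    have hdec := abs_cov_zdPlaquetteObs_le_of_decay (μ := γ Λ η) (N := 2) (by norm_num) hc0 hcl p.1 q.1 p.2.2 q.2.2
    refine hdec.trans (mul_le_mul_of_nonneg_left ?_ hC'0)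
    have := exp_neg_latticeNorm_le_pow (d := 4) (by norm_num) (div_pos hc0 (Real.sqrt_pos.2 h4)).le (p.1 - q.1)
    simpa only [hr, neg_mul] using this
  have hboundμ : ∀ (η : LGConfig 4 (Matrix.specialUnitaryGroup (Fin 2) ℂ)) (p q : ZdPlaquette 4),
      |cov[W p, W q; μ]| ≤ C' * r ^ l1 (p.1 - q.1) := fun η p q =>
    le_of_tendsto' ((hterm p q η).abs) fun n => hbound (Λs n) η p q
  -- boundary insensitivity at the Wilson point
  have hbdry : ∀ (Λ : Finset (ZdEdge 4)) (η : LGConfig 4 (Matrix.specialUnitaryGroup (Fin 2) ℂ))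
      {F : LGConfig 4 (Matrix.specialUnitaryGroup (Fin 2) ℂ) → ℝ} {Δ : Finset (ZdEdge 4)} {K : ℝ≥0}
      (_ : IsLipschitzCylinder (fundamentalRep (Fin 2)) F Δ K) (D' : ℕ)
      (_ : ∀ y ∈ Δ, ∀ z : ZdEdge 4, z ∉ Λ → (D' : ℝ) ≤ ‖y.1 - z.1‖),
      |(∫ U, F U ∂(γ Λ η)) - ∫ U, F U ∂μ| ≤ 2 * Real.sqrt 2 * K * Δ.card * (1 / 2 : ℝ) ^ D' := by
    intro Λ η F Δ K hFl D' hD'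
    have := su2_wilson_boundary_upTo_oneTwelfth h0 h hμ Λ η hFl (D := (D' : ℝ)) hD'
    rwa [Nat.floor_natCast] at this
  -- the constant
  set G : ℝ → ℝ := fun x => numOrient 4 * ((1 + x) / (1 - x)) ^ 4 with hGdef
  set s : ℝ := Real.exp (-(c / 16)) with hs
  have hs0 : 0 ≤ s := (exp_pos _).le
  have hs1 : s < 1 := Real.exp_lt_one_iff.2 (by rw [neg_neg_iff_pos]; positivity)
  have hrs : r = s * s := by rw [hr8, hs, ← Real.exp_add]; congr 1; ring
  set B : ℝ := 2 * Real.sqrt 2 * (64 * 8 + 32 * 4 + 32 * 4) with hB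
  have hB0 : 0 ≤ B := by positivity
  refine ⟨μ, hG, Real.exp c * B * G r + Real.exp c * (2 * C') * G s, fun Λ η p D hD => ?_⟩
  -- summability of both series
  have hsγ : Summable fun q : ZdPlaquette 4 => cov[W p, W q; γ Λ η] :=
    Summable.of_norm_bounded (summable_and_tsum_row_le (d := 4) hC'0 hr0 hr1 p).1
      fun q => by rw [Real.norm_eq_abs]; exact hbound Λ η p q
  have hsμ : Summable fun q : ZdPlaquette 4 => cov[W p, W q; μ] :=
    Summable.of_norm_bounded (summable_and_tsum_row_le (d := 4) hC'0 hr0 hr1 p).1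
      fun q => by rw [Real.norm_eq_abs]; exact hboundμ η p q
  refine ⟨hsγ, hsμ, ?_⟩
  -- the split at `‖x_p − x_q‖₁ ≤ M = ⌊16D/19⌋`: near plaquettes by boundary insensitivity, far ones by clustering
  set M : ℕ := 16 * D / 19 with hM
  set D' : ℕ := D - M - 1 with hD'
  set g : ZdPlaquette 4 → ℝ := fun q =>
    B * (1 / 2 : ℝ) ^ D' * Real.exp (c * M / 8) * r ^ l1 (p.1 - q.1) + 2 * C' * s ^ M * s ^ l1 (p.1 - q.1) with hg
  have hnear : ∀ q : ZdPlaquette 4, l1 (p.1 - q.1) ≤ M →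
      |cov[W p, W q; γ Λ η] - cov[W p, W q; μ]| ≤ B * (1 / 2 : ℝ) ^ D' := by
    intro q hq
    have hdepth := depth_of_union (p := p) (q := q) hD hq
    have hU : ∀ y ∈ plaquetteEdges p, ∀ z : ZdEdge 4, z ∉ Λ → (D' : ℝ) ≤ ‖y.1 - z.1‖ :=
      fun y hy => hdepth y (Finset.mem_union_left _ hy)
    have hV : ∀ y ∈ plaquetteEdges q, ∀ z : ZdEdge 4, z ∉ Λ → (D' : ℝ) ≤ ‖y.1 - z.1‖ :=
      fun y hy => hdepth y (Finset.mem_union_right _ hy)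
    have hprod : IsLipschitzCylinder (fundamentalRep (Fin 2)) (fun U => W p U * W q U)
        (plaquetteEdges p ∪ plaquetteEdges q) (1 * (4 * (2 : ℝ≥0) ^ 3) + 1 * (4 * (2 : ℝ≥0) ^ 3)) :=
      isLipschitzCylinder_mul (hWlip p) (hWlip q) (hWb' p) (hWb' q)
    have hcardU : ((plaquetteEdges p ∪ plaquetteEdges q).card : ℝ) ≤ 8 := by
      have := (Finset.card_union_le _ _).trans (add_le_add (card_plaquetteEdges_le p) (card_plaquetteEdges_le q))
      exact_mod_cast this
    have hcardp : ((plaquetteEdges p).card : ℝ) ≤ 4 := by exact_mod_cast card_plaquetteEdges_le p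
    have hcardq : ((plaquetteEdges q).card : ℝ) ≤ 4 := by exact_mod_cast card_plaquetteEdges_le q
    have hK : (((1 * (4 * (2 : ℝ≥0) ^ 3) + 1 * (4 * (2 : ℝ≥0) ^ 3) : ℝ≥0)) : ℝ) = 64 := by norm_num
    have hK' : (((4 * (2 : ℝ≥0) ^ 3 : ℝ≥0)) : ℝ) = 32 := by norm_num
    have ha : |(∫ U, W p U * W q U ∂(γ Λ η)) - ∫ U, W p U * W q U ∂μ| ≤ 2 * Real.sqrt 2 * 64 * 8 * (1 / 2 : ℝ) ^ D' := by
      have h0 : |(∫ U, W p U * W q U ∂(γ Λ η)) - ∫ U, W p U * W q U ∂μ| ≤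
          2 * Real.sqrt 2 * (((1 * (4 * (2 : ℝ≥0) ^ 3) + 1 * (4 * (2 : ℝ≥0) ^ 3) : ℝ≥0)) : ℝ) *
            ((plaquetteEdges p ∪ plaquetteEdges q).card : ℝ) * (1 / 2 : ℝ) ^ D' := hbdry Λ η hprod D' hdepth
      rw [hK] at h0
      refine h0.trans ?_
      gcongr
    have hb : |(∫ U, W p U ∂(γ Λ η)) - ∫ U, W p U ∂μ| ≤ 2 * Real.sqrt 2 * 32 * 4 * (1 / 2 : ℝ) ^ D' := by
      have h0 : |(∫ U, W p U ∂(γ Λ η)) - ∫ U, W p U ∂μ| ≤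
          2 * Real.sqrt 2 * (((4 * (2 : ℝ≥0) ^ 3 : ℝ≥0)) : ℝ) * ((plaquetteEdges p).card : ℝ) * (1 / 2 : ℝ) ^ D' :=
        hbdry Λ η (hWlip p) D' hU
      rw [hK'] at h0
      refine h0.trans ?_
      gcongr
    have hc' : |(∫ U, W q U ∂(γ Λ η)) - ∫ U, W q U ∂μ| ≤ 2 * Real.sqrt 2 * 32 * 4 * (1 / 2 : ℝ) ^ D' := by
      have h0 : |(∫ U, W q U ∂(γ Λ η)) - ∫ U, W q U ∂μ| ≤
          2 * Real.sqrt 2 * (((4 * (2 : ℝ≥0) ^ 3 : ℝ≥0)) : ℝ) * ((plaquetteEdges q).card : ℝ) * (1 / 2 : ℝ) ^ D' :=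
        hbdry Λ η (hWlip q) D' hV
      rw [hK'] at h0
      refine h0.trans ?_
      gcongr
    -- `cov_γ − cov_μ = (a − a') − (b − b') c − b' (c₁ − c₁')`
    rw [hcov p q (γ Λ η), hcov p q μ]
    set a := ∫ U, W p U * W q U ∂(γ Λ η)
    set a' := ∫ U, W p U * W q U ∂μ
    set b := ∫ U, W p U ∂(γ Λ η)
    set b' := ∫ U, W p U ∂μ
    set e := ∫ U, W q U ∂(γ Λ η)
    set e' := ∫ U, W q U ∂μ
    have hbe : |b| * |e - e'| + |e'| * |b - b'| ≤ |e - e'| + |b - b'| := by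
      have h1 : |b| * |e - e'| ≤ 1 * |e - e'| := mul_le_mul_of_nonneg_right (hWint p (γ Λ η)) (abs_nonneg _)
      have h2 : |e'| * |b - b'| ≤ 1 * |b - b'| := mul_le_mul_of_nonneg_right (hWint q μ) (abs_nonneg _)
      linarith
    calc |a - b * e - (a' - b' * e')| = |(a - a') - (b * (e - e') + e' * (b - b'))| := by
          rw [show a - b * e - (a' - b' * e') = (a - a') - (b * (e - e') + e' * (b - b')) by ring]
      _ ≤ |a - a'| + |b * (e - e') + e' * (b - b')| := abs_sub _ _
      _ ≤ |a - a'| + (|b * (e - e')| + |e' * (b - b')|) := by gcongr; exact abs_add_le _ _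
      _ = |a - a'| + (|b| * |e - e'| + |e'| * |b - b'|) := by rw [abs_mul, abs_mul]
      _ ≤ |a - a'| + (|e - e'| + |b - b'|) := by linarith
      _ ≤ 2 * Real.sqrt 2 * 64 * 8 * (1 / 2 : ℝ) ^ D' +
            (2 * Real.sqrt 2 * 32 * 4 * (1 / 2 : ℝ) ^ D' + 2 * Real.sqrt 2 * 32 * 4 * (1 / 2 : ℝ) ^ D') := by
          gcongr
      _ = B * (1 / 2 : ℝ) ^ D' := by rw [hB]; ring
  have hmaj : ∀ q : ZdPlaquette 4, |cov[W p, W q; γ Λ η] - cov[W p, W q; μ]| ≤ g q := by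
    intro q
    have hg1 : 0 ≤ B * (1 / 2 : ℝ) ^ D' * Real.exp (c * M / 8) * r ^ l1 (p.1 - q.1) := by positivity
    have hg2 : 0 ≤ 2 * C' * s ^ M * s ^ l1 (p.1 - q.1) := by positivity
    rcases le_or_gt (l1 (p.1 - q.1)) M with hq | hq
    · -- near: `1 ≤ e^{cM/8} r^{l1}` since `r^{l1} = e^{−c l1/8} ≥ e^{−c M/8}`
      have hone : 1 ≤ Real.exp (c * M / 8) * r ^ l1 (p.1 - q.1) := by
        rw [hr8, ← Real.exp_nat_mul, ← Real.exp_add]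
        refine Real.one_le_exp ?_
        have : (l1 (p.1 - q.1) : ℝ) ≤ M := by exact_mod_cast hq
        nlinarith
      calc |cov[W p, W q; γ Λ η] - cov[W p, W q; μ]| ≤ B * (1 / 2 : ℝ) ^ D' * 1 := by
            rw [mul_one]; exact hnear q hq
        _ ≤ B * (1 / 2 : ℝ) ^ D' * (Real.exp (c * M / 8) * r ^ l1 (p.1 - q.1)) :=
            mul_le_mul_of_nonneg_left hone (by positivity)
        _ = B * (1 / 2 : ℝ) ^ D' * Real.exp (c * M / 8) * r ^ l1 (p.1 - q.1) := by ring
        _ ≤ g q := le_add_of_nonneg_right hg2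
    · -- far: `|cov_γ| + |cov_μ| ≤ 2 C' r^{l1} = 2 C' s^{l1} s^{l1} ≤ 2 C' s^M s^{l1}`
      have hsl : s ^ l1 (p.1 - q.1) ≤ s ^ M := pow_le_pow_of_le_one hs0 hs1.le hq.le
      calc |cov[W p, W q; γ Λ η] - cov[W p, W q; μ]| ≤ |cov[W p, W q; γ Λ η]| + |cov[W p, W q; μ]| := abs_sub _ _
        _ ≤ C' * r ^ l1 (p.1 - q.1) + C' * r ^ l1 (p.1 - q.1) := add_le_add (hbound Λ η p q) (hboundμ η p q)
        _ = 2 * C' * (s ^ l1 (p.1 - q.1) * s ^ l1 (p.1 - q.1)) := by rw [hrs, mul_pow]; ring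
        _ ≤ 2 * C' * (s ^ M * s ^ l1 (p.1 - q.1)) :=
            mul_le_mul_of_nonneg_left (mul_le_mul_of_nonneg_right hsl (by positivity)) (by positivity)
        _ = 2 * C' * s ^ M * s ^ l1 (p.1 - q.1) := by ring
        _ ≤ g q := le_add_of_nonneg_left hg1
  -- summing the majorant: two `ℓ¹` lattice row sums
  have hrow1 := summable_and_tsum_row_le (d := 4) (c := B * (1 / 2 : ℝ) ^ D' * Real.exp (c * M / 8)) (by positivity) hr0 hr1 p
  have hrow2 := summable_and_tsum_row_le (d := 4) (c := 2 * C' * s ^ M) (by positivity) hs0 hs1 p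
  have hgs : Summable g := hrow1.1.add hrow2.1
  have habs : Summable fun q : ZdPlaquette 4 => |cov[W p, W q; γ Λ η] - cov[W p, W q; μ]| := (hsγ.sub hsμ).abs
  have htsum : |(∑' q, cov[W p, W q; γ Λ η]) - ∑' q, cov[W p, W q; μ]| ≤ ∑' q, g q := by
    rw [← hsγ.tsum_sub hsμ]
    have h1 := norm_tsum_le_tsum_norm (f := fun q : ZdPlaquette 4 => cov[W p, W q; γ Λ η] - cov[W p, W q; μ])
      (by simpa only [Real.norm_eq_abs] using habs)
    simp only [Real.norm_eq_abs] at h1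
    exact h1.trans (habs.tsum_le_tsum hmaj hgs)
  -- the two row sums and the exponent bookkeeping
  have hG0 : ∀ x : ℝ, 0 ≤ x → x < 1 → 0 ≤ G x := fun x hx0 hx1 => by
    rw [hGdef]; exact mul_nonneg (Nat.cast_nonneg _) (pow_nonneg (div_nonneg (by linarith) (by linarith)) 4)
  have hsumg : ∑' q, g q ≤ B * (1 / 2 : ℝ) ^ D' * Real.exp (c * M / 8) * G r + 2 * C' * s ^ M * G s := by
    show ∑' q : ZdPlaquette 4, (B * (1 / 2 : ℝ) ^ D' * Real.exp (c * M / 8) * r ^ l1 (p.1 - q.1) +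
        2 * C' * s ^ M * s ^ l1 (p.1 - q.1)) ≤ _
    rw [hrow1.1.tsum_add hrow2.1]
    exact add_le_add hrow1.2 hrow2.2
  have hhalf : (1 / 2 : ℝ) ^ D' = Real.exp (-(c * D')) := by
    rw [show -(c * (D' : ℝ)) = (D' : ℝ) * (-c) by ring, Real.exp_nat_mul, Real.exp_neg, hc,
      Real.exp_log (by norm_num : (0 : ℝ) < 2), one_div]
  have hnear_exp : (1 / 2 : ℝ) ^ D' * Real.exp (c * M / 8) ≤ Real.exp c * Real.exp (-(c / 19) * D) := by
    rw [hhalf, hD', hM]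
    exact susceptibilityRate_near_exponent_le hc0.le D
  have hfar_exp : s ^ M ≤ Real.exp c * Real.exp (-(c / 19) * D) := by
    rw [hs, hM]; exact susceptibilityRate_far_exponent_le hc0.le D
  calc |(∑' q, cov[W p, W q; γ Λ η]) - ∑' q, cov[W p, W q; μ]| ≤ ∑' q, g q := htsum
    _ ≤ B * (1 / 2 : ℝ) ^ D' * Real.exp (c * M / 8) * G r + 2 * C' * s ^ M * G s := hsumg
    _ = B * ((1 / 2 : ℝ) ^ D' * Real.exp (c * M / 8)) * G r + 2 * C' * s ^ M * G s := by ring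
    _ ≤ B * (Real.exp c * Real.exp (-(c / 19) * D)) * G r + 2 * C' * (Real.exp c * Real.exp (-(c / 19) * D)) * G s :=
        add_le_add (mul_le_mul_of_nonneg_right (mul_le_mul_of_nonneg_left hnear_exp hB0) (hG0 r hr0 hr1))
          (mul_le_mul_of_nonneg_right (mul_le_mul_of_nonneg_left hfar_exp (mul_nonneg zero_le_two hC'0)) (hG0 s hs0 hs1))
    _ = (Real.exp c * B * G r + Real.exp c * (2 * C') * G s) * Real.exp (-(c / 19) * D) := by ring

end KernelSusceptibilityRate

end Summit.Ventures.YMGap.RobustBall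

end
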